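/-
Copyright (c) 2026 the pub-hodgecm-mathlib formalisation cell (harness21).  Prover seat hodgecm-mathlib-A-p19 (g27), 2026-09-02.  Road «S3-tree»∕«S3-ram» (LEAD F0P3a-plan (g12)
T11-41∕T11-52; owner p06 (g15)), row (e2) «P-2-ram», organ «(D2-β)-ram, part T (type A): THE TRANSLATION THEOREM FOR THE TAME-RAMIFIED CM INVOLUTION OF THE EIGEN-FIELD» —
the `htrans` binder of ★ p847219 `RationalGoodVectorRamifiedBaseLaw` for torus type A, over ★ `UnramifiedQuadraticDictionary` (part L) and ★ `UnramifiedQuadraticDictionaryNorms`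
(part N); sibling of ★ `UnramifiedQuadraticNormTransferTypeB`.
-/
import Literature.NumberTheory.NumberFields.UnramifiedQuadraticDictionaryNorms   -- ★ part N (this seat): `map_sub_self_lt_one_of_typeA`, `valued_sub_lt_one_iff_mem_maximalIdeal`; brings part L, ★ B-p10 criterion
import Literature.NumberTheory.NumberFields.UnramifiedQuadraticResidueSquares    -- part T₀ (this seat): `exists_sq_near_iff_exists_sq_near_norm` (residue squares of `K` in coordinates)
import HarnessLib

/-!
# The translation theorem `y ∈ N(K^×) ⟺ y·ι′y ∈ ι₁ N(F_v^×)` for the involution `s̃` of TAME-RAMIFIED type on the unramified quadratic extension `K = F_v(θ)`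
# (Serre, *Local Fields* V §3 Cor. 2, XIV §4; Neukirch II (4.3), V (1.2))

Topic `NumberTheory/NumberFields`; namespace `Literature.NumberTheory.NumberFields`.  THEOREMS ONLY (no definition, no instance, no notation, no named fact, no `sorry`); kernel lane
`--supports stmt-HodgeConjecture-24833`.  Cell `pub/hodgecm-mathlib` (D-0151), crux H413; road «S3-tree», seeding wave «S3-ram», row (e2) «P-2-ram»; organ **«(D2-β)-ram, part T,
torus type A»** (this seat).  Frame of ★ `UnramifiedQuadraticDictionary`: `K = E_w = F_v(θ)`, `θ² = ι₁ d` (`ι₁ = toPlace v w`), `d` a unit of `F_v` that is residually a NON-square,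
`|2| = 1`; `s` an involution of `F_v` of TAME-RAMIFIED type — residually trivial on `𝒪[F_v]`, fixing `d`, with an ANTI-fixed element `ϖ` such that every non-zero `s`-FIXED element has
valuation an EVEN power `|ϖ|^{2k}` (at a CM place: `ϖ` an anti-fixed uniformiser of `L_w`, the fixed field `L⁺_v` having value group `|ϖ|^{2ℤ}`); `s̃` the lift with `s̃θ = θ`
(the CM involution of torus TYPE A: `σ_K := s̃`, `K ∕ K^{s̃}` tame-RAMIFIED), `ι′` the `F_v`-involution with `ι′θ = −θ`.

* §1 **`exists_mul_map_eq_iff_exists_sq_near_typeA`** — ★ B-p10's criterion for `(𝒪[K], s̃)` (residually trivial by ★ part N): an `s̃`-fixed unit `u` of `K` is an `s̃`-norm iff it is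
  residually a square.
* §2 **`exists_norm_iff_exists_rational_norm_typeA`** — THE TRANSLATION THEOREM (type A): for `y ∈ K^×` with `s̃y = y`,
  `(∃ b, b·s̃b·y = 1) ↔ ∃ a, ι′a = a ∧ a·s̃a·(y·ι′y) = 1`.  Proof: `y = u·P` with `P := (ι₁ϖ)^{2k}` (`s̃`- and `ι′`-fixed) and `u` an `s̃`-fixed unit; `P = N_{s̃}((e₁·ι₁ϖ)^k)` where
  `e₁·s̃e₁ = −1` (§1: `−1` is residually a square, by `hsqF`), so `y ∈ N ⟺ u ∈ N ⟺ ū` square (§1); and `y·ι′y = ι₁((a² − b²d)·ϖ^{4k})` with `u = ι₁a + ι₁bθ`, so the right side is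
  `a² − b²d ∈ N(F_v^×)` up to the norm `ϖ^{2k}·s(ϖ^{2k}) = ϖ^{4k}`, i.e. (base criterion `hU1F` for `s`-fixed units of `F_v`) `a² − b²d` residually a square — part T₀ `exists_sq_near_iff_exists_sq_near_norm` closes.
  Together with ★ `exists_norm_comp_iff_exists_rational_norm_typeB` this discharges `htrans` of ★ `SymmetricEigenframe.exists_norm_symmCriterion_iff_exists_rational_norm` for both
  torus types, modulo BASE facts on `(F_v, s, d)` of ★ `RamifiedPlaceUnitNorms` (U1)–(U3) shape.  HONEST LABEL: HC_CM is proved only modulo the 2 remaining named inputs (hLiu418 24832,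
  h413 24833) until rung 0 closes; local algebra, count-neutral.

## References
* [SerreLocalFields1979] J.-P. Serre, *Local Fields*, GTM 67 (1979): Ch. V §3 Prop. 5 and Cor. 2 (tamely ramified quadratic: `N U_K = U ∩` residue squares), Ch. XIV §4 (local symbols
  for `p ≠ 2`), Ch. II §4 Prop. 7 (Hensel).
* [Neukirch1999] J. Neukirch, *Algebraic Number Theory*, Grundlehren 322 (1999): Ch. II (4.3) (squares in finite and local fields), Ch. V (1.2) (norm groups of unramified ∕ tame
  extensions).
-/

set_option autoImplicit false

noncomputable section

open NumberField IsDedekindDomain Polynomial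
open scoped ValuativeRel
open Literature.NumberTheory.Automorphic Literature.NumberTheory.Automorphic.UnitaryGroup Literature.NumberTheory.LocalFields

namespace Literature.NumberTheory.NumberFields

variable {F : Type} (E : Type) [Field F] [NumberField F] [Field E] [NumberField E] [Algebra F E]
  (v : HeightOneSpectrum (𝓞 F)) (w : PlacesOver E v)

/-! ## §1 The norm criterion for `(𝒪[K], s̃)`: an `s̃`-fixed unit is an `s̃`-norm iff it is residually a square -/

/-- **★ B-p10's criterion for the type-A involution `s̃` of `K = F_v(θ)`.**  With `s` residually trivial on `𝒪[F_v]` (so `s̃` is residually trivial on `𝒪[K]`, ★ part N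
`map_sub_self_lt_one_of_typeA`), `s̃` isometric and `|2| = 1`: an `s̃`-fixed unit `u` of `K` satisfies `(∃ e, e·s̃e = u) ↔ ∃ t ∈ 𝒪[K], |u − t²| < 1`
(★ `RamifiedQuadraticNorm.exists_mul_map_eq_iff_isSquare_residue`, unfolded from `𝒪[K]`∕`𝓀_K` to `K`). [cite: SerreLocalFields1979, Ch. V §3 Prop. 5, Cor. 2] -/
theorem exists_mul_map_eq_iff_exists_sq_near_typeA (h2F : Valued.v (2 : v.adicCompletion F) = 1)
    (s : v.adicCompletion F →+* v.adicCompletion F) (hsres : ∀ x : v.adicCompletion F, Valued.v x ≤ 1 → Valued.v (s x - x) < 1)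
    {θ : w.1.adicCompletion E}
    (hval : ∀ p q : v.adicCompletion F, Valued.v (toPlace v w p + toPlace v w q * θ) = max (Valued.v p) (Valued.v q))
    (hcoord : ∀ z : w.1.adicCompletion E, ∃ pq : v.adicCompletion F × v.adicCompletion F, z = toPlace v w pq.1 + toPlace v w pq.2 * θ)
    (s' : w.1.adicCompletion E →+* w.1.adicCompletion E) (hs' : ∀ x, s' (toPlace v w x) = toPlace v w (s x)) (hs'θ : s' θ = θ) (hs's' : ∀ z, s' (s' z) = z)
    (hs'v : ∀ z, Valued.v (s' z) = Valued.v z)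
    (u : w.1.adicCompletion E) (hu : Valued.v u = 1) (hsu : s' u = u) :
    (∃ e : w.1.adicCompletion E, e * s' e = u) ↔ ∃ t : w.1.adicCompletion E, Valued.v t ≤ 1 ∧ Valued.v (u - t ^ 2) < 1 := by
  have hιv : ∀ x, Valued.v (toPlace v w x) = Valued.v x := fun x => by
    have h := hval x 0
    rwa [map_zero, zero_mul, add_zero, map_zero, max_eq_left zero_le] at h
  have h2 : Valued.v (2 : w.1.adicCompletion E) = 1 := by rw [← map_ofNat (toPlace v w) 2, hιv]; exact h2F
  have hs'O : ∀ z : 𝒪[w.1.adicCompletion E], s' z ∈ 𝒪[w.1.adicCompletion E] := fun z =>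
    (v_le_one_iff_mem_integer _).1 (by rw [hs'v]; exact (v_le_one_iff_mem_integer (z : w.1.adicCompletion E)).2 z.2)
  set σO : 𝒪[w.1.adicCompletion E] →+* 𝒪[w.1.adicCompletion E] :=
    (s'.comp (𝒪[w.1.adicCompletion E]).subtype).codRestrict (𝒪[w.1.adicCompletion E]) fun x => hs'O x with hσOdef
  have hσσ : ∀ x, σO (σO x) = x := fun x => Subtype.ext (hs's' x)
  have hres : ∀ x : 𝒪[w.1.adicCompletion E], σO x - x ∈ IsLocalRing.maximalIdeal 𝒪[w.1.adicCompletion E] := fun x => by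
    rw [valued_sub_lt_one_iff_mem_maximalIdeal]
    exact map_sub_self_lt_one_of_typeA E v w s hsres hval hcoord s' hs' hs'θ x ((v_le_one_iff_mem_integer (x : w.1.adicCompletion E)).2 x.2)
  have h2O : IsUnit (2 : 𝒪[w.1.adicCompletion E]) := isUnit_two_integer_of_v_two_eq_one w.1 h2
  set uO : 𝒪[w.1.adicCompletion E] := ⟨u, (v_le_one_iff_mem_integer u).1 hu.le⟩ with huOdef
  have huO : IsUnit uO := isUnit_integer_of_v_eq_one w.1 hu
  have hσu : σO uO = uO := Subtype.ext hsu
  have crit := RamifiedQuadraticNorm.exists_mul_map_eq_iff_isSquare_residue σO hσσ hres h2O huO hσu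
  constructor
  · rintro ⟨e, he⟩
    -- `e` is a unit: `|e|² = |u| = 1`
    have he1 : Valued.v e = 1 := by
      have hsq : Valued.v e * Valued.v e = 1 := by rw [← hs'v e]; nth_rewrite 1 [hs'v e]; rw [← map_mul, he, hu]
      rcases lt_trichotomy (Valued.v e) 1 with h | h | h
      · exfalso
        have : Valued.v e * Valued.v e < 1 := lt_of_le_of_lt (mul_le_of_le_one_right' h.le) h
        exact absurd hsq this.ne
      · exact h
      · exfalso
        have : 1 < Valued.v e * Valued.v e := lt_of_lt_of_le h (le_mul_of_one_le_right' h.le)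
        exact absurd hsq this.ne'
    set eO : 𝒪[w.1.adicCompletion E] := ⟨e, (v_le_one_iff_mem_integer e).1 he1.le⟩ with heOdef
    have heq : eO * σO eO = uO := Subtype.ext he
    obtain ⟨tbar, ht⟩ := crit.1 ⟨eO, heq⟩
    obtain ⟨tO, rfl⟩ := IsLocalRing.residue_surjective tbar
    refine ⟨tO, (v_le_one_iff_mem_integer (tO : w.1.adicCompletion E)).2 tO.2, ?_⟩
    have h0 : IsLocalRing.residue 𝒪[w.1.adicCompletion E] (uO - tO * tO) = 0 := by rw [map_sub, map_mul, ht, sub_self]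
    rw [IsLocalRing.residue_eq_zero_iff, valued_sub_lt_one_iff_mem_maximalIdeal] at h0
    have hcoe : (((uO - tO * tO : 𝒪[w.1.adicCompletion E])) : w.1.adicCompletion E) = u - (tO : w.1.adicCompletion E) ^ 2 := by
      rw [huOdef]; push_cast; ring
    rw [hcoe] at h0
    exact h0
  · rintro ⟨t, ht1, hut⟩
    set tO : 𝒪[w.1.adicCompletion E] := ⟨t, (v_le_one_iff_mem_integer t).1 ht1⟩ with htOdef
    have hres_sq : IsSquare (IsLocalRing.residue 𝒪[w.1.adicCompletion E] uO) := by
      refine ⟨IsLocalRing.residue 𝒪[w.1.adicCompletion E] tO, ?_⟩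
      rw [← map_mul, ← sub_eq_zero, ← map_sub, IsLocalRing.residue_eq_zero_iff, valued_sub_lt_one_iff_mem_maximalIdeal]
      have hcoe : (((uO - tO * tO : 𝒪[w.1.adicCompletion E])) : w.1.adicCompletion E) = u - t ^ 2 := by
        rw [huOdef, htOdef]; push_cast; ring
      rw [hcoe]
      exact hut
    obtain ⟨eO, he⟩ := crit.2 hres_sq
    exact ⟨eO, congrArg Subtype.val he⟩

/-! ## §2 The translation theorem for torus type A -/

/-- **THE TRANSLATION THEOREM, TYPE A** (`σ_K := s̃`, `s̃θ = θ`; `K ∕ K^{s̃}` tame-ramified).  In the frame of ★ `UnramifiedQuadraticDictionary` with a base involution `s` of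
tame-ramified type (residually trivial, `sd = d`, `d` residually a non-square, residue dichotomy `hsqF`, base criterion `hU1F` «an `s`-fixed unit of `F_v` is an `s`-norm iff it
is residually a square», an anti-fixed `ϖ` with every non-zero `s`-fixed element of valuation `|ϖ|^{2k}`): for `y ∈ K^×` with `s̃y = y`,
`(∃ b, b·s̃b·y = 1) ↔ ∃ a, ι′a = a ∧ a·s̃a·(y·ι′y) = 1` — the `htrans` binder of ★ `SymmetricEigenframe.exists_norm_symmCriterion_iff_exists_rational_norm` for type A.
[cite: SerreLocalFields1979, Ch. V §3 Cor. 2; Ch. XIV §4] [cite: Neukirch1999, Ch. V (1.2)] -/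
theorem exists_norm_iff_exists_rational_norm_typeA (h2F : Valued.v (2 : v.adicCompletion F) = 1)
    (s : v.adicCompletion F →+* v.adicCompletion F) (hsres : ∀ x : v.adicCompletion F, Valued.v x ≤ 1 → Valued.v (s x - x) < 1)
    {d : v.adicCompletion F} (hsd : s d = d) (hdv : Valued.v d = 1)
    (hdres : ∀ c : v.adicCompletion F, Valued.v c ≤ 1 → ¬ Valued.v (d - c ^ 2) < 1)
    (hsqF : ∀ g : v.adicCompletion F, Valued.v g = 1 →
      ∃ r : v.adicCompletion F, Valued.v r ≤ 1 ∧ (Valued.v (g - r ^ 2) < 1 ∨ Valued.v (g - r ^ 2 * d) < 1))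
    (hU1F : ∀ g : v.adicCompletion F, Valued.v g = 1 → s g = g →
      ((∃ z : v.adicCompletion F, z * s z = g) ↔ ∃ c : v.adicCompletion F, Valued.v c ≤ 1 ∧ Valued.v (g - c ^ 2) < 1))
    {ϖ : v.adicCompletion F} (hϖ0 : ϖ ≠ 0) (hsϖ : s ϖ = -ϖ)
    (hvalF : ∀ p : v.adicCompletion F, p ≠ 0 → s p = p → ∃ k : ℤ, Valued.v p = Valued.v ϖ ^ (2 * k))
    {θ : w.1.adicCompletion E} (hθ : θ ^ 2 = toPlace v w d)
    (hval : ∀ p q : v.adicCompletion F, Valued.v (toPlace v w p + toPlace v w q * θ) = max (Valued.v p) (Valued.v q))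
    (hcoord : ∀ z : w.1.adicCompletion E, ∃ pq : v.adicCompletion F × v.adicCompletion F, z = toPlace v w pq.1 + toPlace v w pq.2 * θ)
    (s' ι' : w.1.adicCompletion E →+* w.1.adicCompletion E) (hs' : ∀ x, s' (toPlace v w x) = toPlace v w (s x)) (hs'θ : s' θ = θ)
    (hs's' : ∀ z, s' (s' z) = z) (hs'v : ∀ z, Valued.v (s' z) = Valued.v z)
    (hι' : ∀ x, ι' (toPlace v w x) = toPlace v w x) (hι'θ : ι' θ = -θ) (hι'v : ∀ z, Valued.v (ι' z) = Valued.v z)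
    (hfix : ∀ z : w.1.adicCompletion E, ι' z = z → ∃ x, toPlace v w x = z)
    (y : w.1.adicCompletion E) (hy : y ≠ 0) (hσy : s' y = y) :
    (∃ b : w.1.adicCompletion E, b * s' b * y = 1) ↔
      ∃ a : w.1.adicCompletion E, ι' a = a ∧ a * s' a * (y * ι' y) = 1 := by
  have hιv : ∀ x, Valued.v (toPlace v w x) = Valued.v x := fun x => by
    have h := hval x 0
    rwa [map_zero, zero_mul, add_zero, map_zero, max_eq_left zero_le] at h
  -- uniqueness of the unramified coordinates (from `hval`)
  have huniq : ∀ p q p' q' : v.adicCompletion F, toPlace v w p + toPlace v w q * θ = toPlace v w p' + toPlace v w q' * θ → p = p' ∧ q = q' := by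
    intro p q p' q' h
    have h0 : toPlace v w (p - p') + toPlace v w (q - q') * θ = 0 := by rw [map_sub, map_sub]; linear_combination h
    have hm := hval (p - p') (q - q')
    rw [h0, map_zero] at hm
    have hp : Valued.v (p - p') = 0 := le_antisymm (hm.symm ▸ le_max_left _ _) zero_le
    have hq : Valued.v (q - q') = 0 := le_antisymm (hm.symm ▸ le_max_right _ _) zero_le
    exact ⟨sub_eq_zero.1 ((Valuation.zero_iff _).1 hp), sub_eq_zero.1 ((Valuation.zero_iff _).1 hq)⟩
  -- coordinates of an `s̃`-fixed element are `s`-fixed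
  have hfixed : ∀ z : w.1.adicCompletion E, s' z = z → ∀ p q, z = toPlace v w p + toPlace v w q * θ → s p = p ∧ s q = q := by
    intro z hz p q hzpq
    have h1 : s' z = toPlace v w (s p) + toPlace v w (s q) * θ := by rw [hzpq, map_add, map_mul, hs', hs', hs'θ]
    rw [hz, hzpq] at h1
    obtain ⟨hp, hq⟩ := huniq _ _ _ _ h1
    exact ⟨hp.symm, hq.symm⟩
  -- STEP 1: `|y| = |ϖ|^{2k}`
  obtain ⟨⟨p, q⟩, hypq⟩ := hcoord y
  obtain ⟨hsp, hsq⟩ := hfixed y hσy p q hypq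
  obtain ⟨k, hk⟩ : ∃ k : ℤ, Valued.v y = Valued.v ϖ ^ (2 * k) := by
    have hvy : Valued.v y = max (Valued.v p) (Valued.v q) := by rw [hypq, hval]
    by_cases hp0 : p = 0
    · have hq0 : q ≠ 0 := by
        rintro rfl
        apply hy
        rw [hypq, hp0, map_zero, zero_mul, add_zero]
      obtain ⟨k, hk⟩ := hvalF q hq0 hsq
      exact ⟨k, by rw [hvy, hp0, map_zero, max_eq_right zero_le, hk]⟩
    · obtain ⟨k₁, hk₁⟩ := hvalF p hp0 hsp
      by_cases hq0 : q = 0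
      · exact ⟨k₁, by rw [hvy, hq0, map_zero, max_eq_left zero_le, hk₁]⟩
      · obtain ⟨k₂, hk₂⟩ := hvalF q hq0 hsq
        rcases le_total (Valued.v p) (Valued.v q) with h | h
        · exact ⟨k₂, by rw [hvy, max_eq_right h, hk₂]⟩
        · exact ⟨k₁, by rw [hvy, max_eq_left h, hk₁]⟩
  -- STEP 2: `y = u·P`, `P = (ι₁ϖ)^{2k}` fixed by `s̃` and `ι′`, `u` an `s̃`-fixed unit
  obtain ⟨piK, hpiKdef⟩ : ∃ piK : w.1.adicCompletion E, piK = toPlace v w ϖ := ⟨_, rfl⟩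
  have hpiK0 : piK ≠ 0 := fun h => hϖ0 ((map_eq_zero (toPlace v w)).1 (hpiKdef ▸ h))
  have hs'pi : s' piK = -piK := by rw [hpiKdef, hs', hsϖ, map_neg]
  have hι'pi : ι' piK = piK := by rw [hpiKdef, hι']
  obtain ⟨P, hPdef⟩ : ∃ P : w.1.adicCompletion E, P = piK ^ (2 * k) := ⟨_, rfl⟩
  have hP0 : P ≠ 0 := by rw [hPdef]; exact zpow_ne_zero _ hpiK0
  have hs'P : s' P = P := by rw [hPdef, map_zpow₀, hs'pi, Even.neg_zpow (even_two_mul k)]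
  have hι'P : ι' P = P := by rw [hPdef, map_zpow₀, hι'pi]
  have hPι : P = toPlace v w (ϖ ^ (2 * k)) := by rw [hPdef, hpiKdef, map_zpow₀]
  have hsϖk : s (ϖ ^ (2 * k)) = ϖ ^ (2 * k) := by rw [map_zpow₀, hsϖ, Even.neg_zpow (even_two_mul k)]
  have hvP : Valued.v P = Valued.v y := by rw [hPdef, map_zpow₀, hpiKdef, hιv, ← hk]
  obtain ⟨u, hudef⟩ : ∃ u : w.1.adicCompletion E, u = y * P⁻¹ := ⟨_, rfl⟩
  have hvy0 : Valued.v y ≠ 0 := (Valuation.ne_zero_iff _).2 hy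
  have hu1 : Valued.v u = 1 := by rw [hudef, map_mul, map_inv₀, hvP, mul_inv_cancel₀ hvy0]
  have hu0 : u ≠ 0 := fun h => by rw [h, map_zero] at hu1; exact zero_ne_one hu1
  have hs'u : s' u = u := by rw [hudef, map_mul, map_inv₀, hσy, hs'P]
  have hyu : y = u * P := by rw [hudef, inv_mul_cancel_right₀ hP0]
  -- STEP 3: `P` is an `s̃`-norm: `−1 = e₁·s̃e₁` (§1: `−1` is residually a square by `hsqF`), `(e₁·ι₁ϖ)·s̃(e₁·ι₁ϖ) = (ι₁ϖ)²`
  have hθv : Valued.v θ = 1 := by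
    have h := hval 0 1
    rwa [map_zero, map_one, zero_add, one_mul, map_zero, map_one, max_eq_right zero_le] at h
  have hneg1 : ∃ e₁ : w.1.adicCompletion E, e₁ * s' e₁ = -1 := by
    refine (exists_mul_map_eq_iff_exists_sq_near_typeA E v w h2F s hsres hval hcoord s' hs' hs'θ hs's' hs'v (-1)
      (by rw [Valuation.map_neg, map_one]) (by rw [map_neg, map_one])).2 ?_
    obtain ⟨r, hr1, hr⟩ := hsqF (-1) (by rw [Valuation.map_neg, map_one])
    rcases hr with hr | hr
    · refine ⟨toPlace v w r, by rw [hιv]; exact hr1, ?_⟩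
      rw [← map_pow, ← (toPlace v w).map_one, ← map_neg, ← map_sub, hιv]; exact hr
    · refine ⟨toPlace v w r * θ, by rw [map_mul, hιv, hθv, mul_one]; exact hr1, ?_⟩
      have heq : (-1 : w.1.adicCompletion E) - (toPlace v w r * θ) ^ 2 = toPlace v w (-1 - r ^ 2 * d) := by
        rw [mul_pow, hθ, map_sub, map_neg, map_one, map_mul, map_pow]
      rw [heq, hιv]; exact hr
  obtain ⟨e₁, he₁⟩ := hneg1
  have hg : ∃ g : w.1.adicCompletion E, g * s' g = P := by
    refine ⟨(e₁ * piK) ^ k, ?_⟩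
    have h1 : (e₁ * piK) * s' (e₁ * piK) = piK ^ 2 := by
      rw [map_mul, hs'pi]
      linear_combination (-(piK ^ 2)) * he₁
    rw [map_zpow₀, ← mul_zpow, h1, hPdef, zpow_mul, zpow_ofNat]
  obtain ⟨g, hgP⟩ := hg
  have hg0 : g ≠ 0 := fun h => hP0 (by rw [← hgP, h, zero_mul])
  have hsg0 : s' g ≠ 0 := fun h => hP0 (by rw [← hgP, h, mul_zero])
  -- STEP 4: the left side is `u ∈ N(s̃)`
  have hL : (∃ b : w.1.adicCompletion E, b * s' b * y = 1) ↔ ∃ f : w.1.adicCompletion E, f * s' f = u := by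
    constructor
    · rintro ⟨b, hb⟩
      have hy' : y = (b * s' b)⁻¹ := eq_inv_of_mul_eq_one_right hb
      refine ⟨(b * g)⁻¹, ?_⟩
      rw [hudef, hy', ← hgP, map_inv₀, map_mul]
      ring
    · rintro ⟨f, hf⟩
      have hf0 : f ≠ 0 := fun h => hu0 (by rw [← hf, h, zero_mul])
      have hsf0 : s' f ≠ 0 := fun h => hu0 (by rw [← hf, h, mul_zero])
      refine ⟨(f * g)⁻¹, ?_⟩
      rw [hyu, ← hf, ← hgP, map_inv₀, map_mul]
      field_simp
  -- STEP 5: coordinates of `u`, the norm `N₀ = a² − b²d`, and the right side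
  obtain ⟨⟨a₀, b₀⟩, hu⟩ := hcoord u
  obtain ⟨hsa, hsb⟩ := hfixed u hs'u a₀ b₀ hu
  have hab1 : max (Valued.v a₀) (Valued.v b₀) = 1 := by rw [← hval, ← hu, hu1]
  have ha1 : Valued.v a₀ ≤ 1 := hab1 ▸ le_max_left _ _
  have hb1 : Valued.v b₀ ≤ 1 := hab1 ▸ le_max_right _ _
  have huι : u * ι' u = toPlace v w (a₀ ^ 2 - b₀ ^ 2 * d) := by
    have hι'u : ι' u = toPlace v w a₀ - toPlace v w b₀ * θ := by rw [hu, map_add, map_mul, hι', hι', hι'θ]; ring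
    rw [hι'u, hu, map_sub, map_mul, map_pow, map_pow, ← hθ]; ring
  have hsN : s (a₀ ^ 2 - b₀ ^ 2 * d) = a₀ ^ 2 - b₀ ^ 2 * d := by rw [map_sub, map_mul, map_pow, map_pow, hsa, hsb, hsd]
  have hN1 : Valued.v (a₀ ^ 2 - b₀ ^ 2 * d) = 1 := by rw [← hιv, ← huι, map_mul, hι'v, hu1, mul_one]
  have hyι : y * ι' y = toPlace v w ((a₀ ^ 2 - b₀ ^ 2 * d) * (ϖ ^ (2 * k) * ϖ ^ (2 * k))) := by
    rw [hyu, map_mul, hι'P, map_mul, map_mul, ← huι, ← hPι]; ring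
  have hϖk0 : ϖ ^ (2 * k) ≠ 0 := zpow_ne_zero _ hϖ0
  have hR : (∃ a : w.1.adicCompletion E, ι' a = a ∧ a * s' a * (y * ι' y) = 1) ↔ ∃ z : v.adicCompletion F, z * s z = a₀ ^ 2 - b₀ ^ 2 * d := by
    constructor
    · rintro ⟨a, hιa, ha⟩
      obtain ⟨c, rfl⟩ := hfix a hιa
      rw [hs', hyι, ← map_mul, ← map_mul, ← (toPlace v w).map_one] at ha
      have key := (toPlace v w).injective ha
      have hc0 : c ≠ 0 := by
        rintro rfl
        rw [zero_mul, zero_mul] at key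
        exact zero_ne_one key
      have key' : (c * s c * (ϖ ^ (2 * k) * ϖ ^ (2 * k))) * (a₀ ^ 2 - b₀ ^ 2 * d) = 1 := by linear_combination key
      refine ⟨(c * ϖ ^ (2 * k))⁻¹, ?_⟩
      rw [map_inv₀, map_mul, hsϖk, eq_inv_of_mul_eq_one_right key']
      ring
    · rintro ⟨z, hz⟩
      have hN0 : a₀ ^ 2 - b₀ ^ 2 * d ≠ 0 := fun h => by rw [h, map_zero] at hN1; exact zero_ne_one hN1
      have hz0 : z ≠ 0 := fun h => hN0 (by rw [← hz, h, zero_mul])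
      have hsz0 : s z ≠ 0 := fun h => hN0 (by rw [← hz, h, mul_zero])
      refine ⟨(toPlace v w (z * ϖ ^ (2 * k)))⁻¹, by rw [map_inv₀, hι'], ?_⟩
      rw [map_inv₀, hs', hyι, ← hz, map_mul s, hsϖk, ← map_inv₀, ← map_inv₀, ← map_mul, ← map_mul, ← (toPlace v w).map_one]
      congr 1
      field_simp
  -- STEP 6: assemble — §1 for `u`, the base criterion for `N₀`, and part T₀ (residue squares in coordinates)
  rw [hL, hR, exists_mul_map_eq_iff_exists_sq_near_typeA E v w h2F s hsres hval hcoord s' hs' hs'θ hs's' hs'v u hu1 hs'u,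
    hU1F _ hN1 hsN, hu]
  exact exists_sq_near_iff_exists_sq_near_norm E v w h2F hdv hdres hsqF hθ hval hcoord a₀ b₀ ha1 hb1 hab1

end Literature.NumberTheory.NumberFields

end
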